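import Summits.AtomisticToContinuum.HydrodynamicLimit.Theorems.InfluenceLocality.Negative.TubeEnclosure
import HarnessLib

/-!
# `InfluenceLocality` (stmt-AtomisticToContinuum-13916) — forward invariance of tubes (stub `stub_tubeInv`)

Line `ignition-cascade-refutation` (lead c3), Phase 2 (construction of `IgnitionTemplates`). The phase sets of the
eventual phase script (Negative/PhaseScript.lean, `PhaseScript.TrackValid`) are TIME-WINDOWED FREE-FLIGHT TUBES on
the flat torus `T3`: states `(t, x, v)` with `ts ≤ t`, `‖v - v₀‖ ≤ δv`, and whose back-extrapolation
`x + proj ((t₀ - t) • v)` to the nominal time `t₀` lies within `δx` (minimal-image distance `Torus.euclidDist`) of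
the nominal point `x₀`. This file discharges the `inv` field of `PhaseScript.TrackValid` for such tubes: forward
free flight of duration `s ≥ 0`, `(t, x, v) ↦ (t + s, x + proj (s • v), v)`, stays in the tube.
Design-independent; asserts no Theses decl.
-/

namespace Summit.AtomisticToContinuum.HydrodynamicLimit.Theorems.InfluenceLocality.Negative

open MeasureTheory Set
open scoped InnerProductSpace
open Literature.Analysis.FluidPDE Literature.MathematicalPhysics.KineticTheory
open Literature.Analysis.FunctionSpaces

noncomputable section

/-- FORWARD INVARIANCE OF TIME-WINDOWED TUBES. A state `(t, x, v)` of the time-windowed free-flight tube with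
nominal data `(t₀, x₀, v₀)`, tolerances `(δx, δv)` and opening time `ts` — i.e. `ts ≤ t`, `‖v - v₀‖ ≤ δv`, and the
back-extrapolated position `x + proj ((t₀ - t) • v)` is within `δx` of `x₀` — is mapped by forward free flight of
duration `s ≥ 0` to the state `(t + s, x + proj (s • v), v)`, which lies in the same tube. Proof: the
back-extrapolated position is unchanged, `(x + proj (s • v)) + proj ((t₀ - (t + s)) • v) = x + proj ((t₀ - t) • v)`,
by additivity of `proj` (`Torus.proj_add`) and `s + (t₀ - (t + s)) = t₀ - t`; the time window is kept since
`0 ≤ s`; the velocity tolerance is untouched. -/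
theorem stub_tubeInv :
    ∀ (ts t₀ t s : ℝ) (x₀ x : T3) (v₀ v : V3) (δx δv : ℝ),
    ts ≤ t → ‖v - v₀‖ ≤ δv → Torus.euclidDist (x + Torus.proj ((t₀ - t) • v)) x₀ ≤ δx → 0 ≤ s →
      ts ≤ t + s ∧ ‖v - v₀‖ ≤ δv ∧
        Torus.euclidDist ((x + Torus.proj (s • v)) + Torus.proj ((t₀ - (t + s)) • v)) x₀ ≤ δx := by
  intro ts t₀ t s x₀ x v₀ v δx δv hts hv hx hs
  refine ⟨by linarith, hv, ?_⟩
  -- the back-extrapolated position is unchanged by forward free flight (additivity of `Torus.proj`)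
  have hxeq : (x + Torus.proj (s • v)) + Torus.proj ((t₀ - (t + s)) • v) = x + Torus.proj ((t₀ - t) • v) := by
    rw [add_assoc, ← Torus.proj_add, ← add_smul, show s + (t₀ - (t + s)) = t₀ - t by ring]
  rw [hxeq]
  exact hx

end

end Summit.AtomisticToContinuum.HydrodynamicLimit.Theorems.InfluenceLocality.Negative
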